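import Literature.AlgebraicGeometry.HodgeTheory.CompleteIntersectionGorenstein
import HarnessLib

/-!
# The Artinian Gorenstein ideal of a complete-intersection cycle: `(J^F : det Jac(f, g)) = (f, g)`
# (Villaflor Loyola 2022b Ex. 2.1 / Kloosterman 2023 Lemma 4.12; the transition determinant of nested complete intersections)

Topic `Literature/AlgebraicGeometry/HodgeTheory`. R. Villaflor Loyola, *Small codimension components of the
Hodge locus containing the Fermat variety*, Commun. Contemp. Math. 24 (2022) (arXiv:2001.01019), **Example 2.1**
(reproducing A. Dan's argument; text read: arXiv p. 8): for `X_t = {F = 0}`, `F = f_1 g_1 + ⋯ + f_{n/2+1} g_{n/2+1}`,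
`Z = {f_1 = ⋯ = f_{n/2+1} = 0}` and `λ = [Z]`: "`I := ⟨f_1, g_1, …, f_{n/2+1}, g_{n/2+1}⟩ ⊆ J^{F,λ}`. By Macaulay's
theorem [vo03] it follows that `soc(I) = soc(J^{F,λ})` and so `I = J^{F,λ}`. Therefore
`T_t V_λ = ⟨f_1, g_1, …, f_{n/2+1}, g_{n/2+1}⟩_d`." R. Kloosterman, *Variational Hodge conjecture for complete
intersections on hypersurfaces in projective space*, Rend. Sem. Mat. Univ. Padova 148 (2023) (arXiv:2104.14845),
**Example 4.6**: "Since `Y ⊂ 𝐏^{2k+1}` is smooth, the only such point is the origin, hence these `2k+2` polynomials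
define a scheme-theoretic complete intersection … `S/(P_1, …, P_{k+1}, Q_1, …, Q_{k+1})` is an example of an
Artinian Gorenstein algebra. Its socle degree equals … `(k+1)e − 2k − 2`"; **Remark 4.7**: "If `S/I` and `S/J` are
graded Artinian Gorenstein algebras and `S/J` is a quotient of `S/I` then `J = (I : g)` … Hence the only quotient
of `S/I` with the same socle degree is `S/I` itself"; **Lemma 4.12**: "`I = (P_1, …, P_{k+1}, Q_1, …, Q_{k+1})` and
`T = I_e`." R. Villaflor Loyola, *Periods of complete intersection algebraic cycles*, manuscripta math. 167 (2022),
**Thm. 1**: the primitive class of `Z` is represented in the Jacobian ring by a non-zero multiple of `det(Jac(H))`,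
`H = (f_1, g_1, …, f_{n/2+1}, g_{n/2+1})`. B. de Smit, K. Rubin, R. Schoof, *Criteria for complete intersections*,
**Prop. 2.1** (Tate): for `f_i = Σ_j g_{ij} X_j` generating a complete intersection, the socle of `k[[X]]/(f)` is
`(det g_{ij})`, in particular `det(g_{ij}) ∉ (f)`.

**What this file proves (0 facts, 0 sorry; `K` any field).**

* `det_notMem_and_colon_det_eq_of_eq_mul` — **the transition determinant of nested Artinian complete
  intersections**: if `G_0, …, G_{m−1}` (forms of positive degrees `d_j`, `m` variables, a power of every variable in
  `(G)`) are combinations `G_j = Σ_l B_{jl} h_l` of forms `h_0, …, h_{m−1}` of positive degrees `e_l`, with `det B`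
  a form of degree `Σ d_j − Σ e_l`, then `det B ∉ (G)` and `((G) : det B) = (h)`; here `(G)` and `(h)` are Artinian
  Gorenstein of socle degrees `Σ (d_j − 1)` and `Σ (e_l − 1)` by Macaulay's theorem (file
  `CompleteIntersectionGorenstein.lean`), `(h) ⊆ ((G) : det B)` by Cramer's rule, `det B ∉ (G)` by Wiebe's lemma
  applied to `det(B·a)` where `h = a·x` (tree `det_notMem_span_sup_span_X_pow_of_mem`), and equality is Remark 4.7
  (tree `IsArtinianGorenstein.colon_eq_of_le`).
* `det_ciTransitionMatrix_notMem_and_colon_eq` — **the complete-intersection case**: for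
  `F = Σ_{i=0}^{k} f_i g_i` in `2k + 2` variables (`f_i`, `g_i` forms of positive degrees `a_i + b_i = d`) with
  finite-dimensional Jacobian ring (a power of every variable in `J^F`), the Jacobian determinant
  `D = det (∂(g, f)/∂x)` of the `2k+2` forms satisfies `D ∉ J^F` and
  `(J^F : D) = (f_0, …, f_k) + (g_0, …, g_k)`, an Artinian Gorenstein ideal of socle degree `(k+1)(d−2)`
  (`isArtinianGorenstein_span_sup_span`). This is the algebraic content of Villaflor's Ex. 2.1 / Kloosterman's
  Lemma 4.12 once the class `[Z]_prim` is represented by `c · det Jac(H)` (Villaflor 2022, Thm. 1 — a statement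
  about periods, not formalised here); with the tree's `T_t V_λ = (J^F : P_λ)_d` dictionary it is the printed
  "`T_t V_{[Z]} = ⟨f, g⟩_d`".
* `colon_originIdeal_eq_sup_span_det` — **de Smit–Rubin–Schoof Prop. 2.1 (i) / Cor. 2.2 in the graded polynomial
  ring**: for forms `G_j = Σ_i A_{ji} x_i` of positive degree (`m` forms, `m` variables, a power of every variable
  in `(G)`), the socle of `S/(G)` is the line spanned by the transition determinant:
  `((G) : (x_0, …, x_{m−1})) = (G) + (det A)` and `det A ∉ (G)` (from the key congruence
  `exists_mul_det_sub_mul_mem` of `CompleteIntersectionGorenstein.lean` and Wiebe's lemma).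
* `det_hessianMatrix_notMem_and_colon_originIdeal_eq` — **`det Hess(F)` spans the socle of the Jacobian ring**
  (Villaflor 2022, after Thm. 2: "`R^F_{(d−2)(n+2)} = ℂ·det(Hess(F))`"): for a form `F` of degree `d ≥ 2` with
  `d − 1 ≠ 0` in `K` and finite-dimensional Jacobian ring, `det Hess(F) ∉ J^F` and `(J^F : (x)) = J^F + (det Hess F)`
  (the transition matrix `Hess(F)/(d−1)`, by Euler's identity).

## References

* [Villaflorloyola2021] R. Villaflor Loyola, *Small codimension components of the Hodge locus containing the
  Fermat variety*, Commun. Contemp. Math. 24 (2022) 2150053, Example 2.1.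
* [Kloosterman2023] R. Kloosterman, *Variational Hodge conjecture for complete intersections on hypersurfaces in
  projective space*, Rend. Sem. Mat. Univ. Padova 148 (2023), Example 4.6, Remark 4.7, Lemma 4.12.
* [Villaflor2022PeriodsCI] R. Villaflor Loyola, *Periods of complete intersection algebraic cycles*, manuscripta
  math. 167 (2022) 765–792, Thm. 1.
* [DeSmitRubinSchoof1997] B. de Smit, K. Rubin, R. Schoof, *Criteria for complete intersections*, Prop. 2.1,
  Cor. 2.2.
* [VoisinHodgeII2003] C. Voisin, *Hodge Theory and Complex Algebraic Geometry II*, Thm. 6.19.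
-/

noncomputable section

open MvPolynomial Module
open Literature.RingTheory.MvPolynomial Literature.AlgebraicGeometry.DuqueFrancoVillaflor2025
  Literature.AlgebraicGeometry.Resolution

attribute [local instance] MvPolynomial.gradedAlgebra

namespace Literature.AlgebraicGeometry.HodgeTheory

universe u

variable {K : Type u} [Field K] {m : ℕ}

/-! ### Tools -/

/-- A form of positive degree `d` is a combination of the variables with coefficients forms of degree `d − 1`.
[folklore] -/
private theorem exists_isHomogeneous_eq_sum_mul_X' {G : MvPolynomial (Fin m) K} {d : ℕ}
    (hG : G.IsHomogeneous d) (hd : 0 < d) :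
    ∃ a : Fin m → MvPolynomial (Fin m) K, (∀ j, (a j).IsHomogeneous (d - 1)) ∧ G = ∑ j, a j * X j := by
  have hmem : G ∈ Ideal.span (Set.range (X : Fin m → MvPolynomial (Fin m) K)) := by
    rw [← originIdeal_eq_span, mem_originIdeal_iff, constantCoeff_eq]
    exact hG.coeff_eq_zero (by rw [map_zero]; omega)
  obtain ⟨c, hc⟩ := Ideal.mem_span_range_iff_exists_fun.mp hmem
  refine ⟨fun j => homogeneousComponent (d - 1) (c j), fun j => homogeneousComponent_isHomogeneous _ _, ?_⟩
  have hd1 : d - 1 + 1 = d := Nat.sub_add_cancel hd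
  calc G = homogeneousComponent d G := (homogeneousComponent_eq_self hG).symm
    _ = ∑ j, homogeneousComponent (d - 1 + 1) (X j * c j) := by
        rw [hd1, ← hc, map_sum]
        exact Finset.sum_congr rfl fun j _ => by rw [mul_comm]
    _ = ∑ j, homogeneousComponent (d - 1) (c j) * X j :=
        Finset.sum_congr rfl fun j _ => by
          rw [homogeneousComponent_mul_add_of_isHomogeneous (isHomogeneous_X K j) (c j) (d - 1), mul_comm]

/-- Cramer: if `G_j = Σ_l B_{jl} h_l` then `det B · h_l ∈ (G)` for every `l`. [folklore] -/
private theorem det_mul_mem_span_of_eq_sum {G h : Fin m → MvPolynomial (Fin m) K}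
    {B : Matrix (Fin m) (Fin m) (MvPolynomial (Fin m) K)} (hGB : ∀ j, G j = ∑ l, B j l * h l) (l : Fin m) :
    B.det * h l ∈ Ideal.span (Set.range G) := by
  have hGv : B.mulVec h = G := funext fun j => by
    rw [hGB j]; simp [Matrix.mulVec, dotProduct]
  have h2 := congrArg (fun v => (B.adjugate.mulVec v) l) hGv
  simp only [Matrix.mulVec_mulVec, Matrix.adjugate_mul, Matrix.smul_mulVec, Matrix.one_mulVec] at h2
  have hcramer : B.det * h l = ∑ j, B.adjugate l j * G j := by
    simpa [Matrix.mulVec, dotProduct] using h2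
  rw [hcramer]
  exact Ideal.sum_mem _ fun j _ => Ideal.mul_mem_left _ _ (Ideal.subset_span ⟨j, rfl⟩)

/-! ### The transition determinant of nested Artinian complete intersections -/

/-- **Nested Artinian complete intersections: `det B ∉ (G)` and `((G) : det B) = (h)`.** Let `G_0, …, G_{m−1}` be
forms of positive degrees `d_j` in `m` variables with a power of every variable in `(G)`, and let
`G_j = Σ_l B_{jl} h_l` for forms `h_l` of positive degrees `e_l` and a matrix `B` whose determinant is a form of
degree `t` with `t + Σ (e_l − 1) = Σ (d_j − 1)`. Then the transition determinant `det B` is not in `(G)`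
(de Smit–Rubin–Schoof Prop. 2.1 / Wiebe) and `((G) : det B) = (h_0, …, h_{m−1})`: both sides are Artinian
Gorenstein of socle degree `Σ (e_l − 1)` (Macaulay) and the right is contained in the left (Cramer), so they
coincide (Kloosterman 2023, Remark 4.7: "the only quotient of `S/I` with the same socle degree is `S/I` itself").
[cite: Kloosterman2023, Remark 4.7] [cite: DeSmitRubinSchoof1997, Prop. 2.1] [cite: VoisinHodgeII2003, Thm. 6.19] -/
theorem det_notMem_and_colon_det_eq_of_eq_mul (G h : Fin m → MvPolynomial (Fin m) K) (d e : Fin m → ℕ)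
    (hG : ∀ j, (G j).IsHomogeneous (d j)) (hd : ∀ j, 0 < d j) (hh : ∀ l, (h l).IsHomogeneous (e l))
    (he : ∀ l, 0 < e l) {N : ℕ} (hN : 0 < N)
    (hXN : ∀ i, (X i : MvPolynomial (Fin m) K) ^ N ∈ Ideal.span (Set.range G))
    (B : Matrix (Fin m) (Fin m) (MvPolynomial (Fin m) K)) (hGB : ∀ j, G j = ∑ l, B j l * h l)
    {t : ℕ} (hBt : B.det.IsHomogeneous t) (ht : t + ∑ l, (e l - 1) = ∑ j, (d j - 1)) :
    B.det ∉ Ideal.span (Set.range G) ∧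
      (Ideal.span (Set.range G)).colon {B.det} = Ideal.span (Set.range h) := by
  classical
  set J : Ideal (MvPolynomial (Fin m) K) := Ideal.span (Set.range G) with hJ
  set I : Ideal (MvPolynomial (Fin m) K) := Ideal.span (Set.range h) with hI
  have hJI : J ≤ I := by
    rw [hJ, Ideal.span_le]
    rintro _ ⟨j, rfl⟩
    rw [hGB j]
    exact Ideal.sum_mem _ fun l _ => Ideal.mul_mem_left _ _ (Ideal.subset_span ⟨l, rfl⟩)
  have hAGJ : IsArtinianGorenstein J (∑ j, (d j - 1)) := isArtinianGorenstein_span_of_X_pow_mem G d hG hd hN hXN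
  have hAGI : IsArtinianGorenstein I (∑ l, (e l - 1)) :=
    isArtinianGorenstein_span_of_X_pow_mem h e hh he hN fun i => hJI (hXN i)
  -- `det B ∉ J`: Wiebe's lemma for the composite transition matrix `B · a`, `h = a · x`
  choose a ha hha using fun l => exists_isHomogeneous_eq_sum_mul_X' (hh l) (he l)
  set A : Matrix (Fin m) (Fin m) (MvPolynomial (Fin m) K) := Matrix.of a with hA
  have hGBA : ∀ j, G j = ∑ i, (B * A) j i * X i := by
    intro j
    rw [hGB j]
    simp only [Matrix.mul_apply, hA, Matrix.of_apply, Finset.sum_mul]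
    rw [Finset.sum_comm]
    refine Finset.sum_congr rfl fun l _ => ?_
    rw [hha l, Finset.mul_sum]
    exact Finset.sum_congr rfl fun i _ => by ring
  have hdet : B.det ∉ J := by
    intro hBJ
    have h1 : (B * A).det ∈ J := by
      rw [Matrix.det_mul]
      exact J.mul_mem_right _ hBJ
    exact Literature.RingTheory.CompleteIntersection.det_notMem_span_sup_span_X_pow_of_mem (B * A) G 1 hN hGBA
      (fun i => by rw [one_mul]; exact hXN i) (by simp) (Ideal.mem_sup_left h1)
  refine ⟨hdet, ?_⟩
  -- `I ⊆ (J : det B)` by Cramer, and both are Artinian Gorenstein of socle `Σ (e_l − 1)`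
  refine hAGJ.colon_eq_of_le hBt ht hdet hAGI fun q hq => ?_
  rw [Submodule.mem_colon_singleton, smul_eq_mul, mul_comm]
  refine Submodule.span_induction (p := fun q _ => B.det * q ∈ J) ?_ ?_ ?_ ?_ hq
  · rintro _ ⟨l, rfl⟩
    exact det_mul_mem_span_of_eq_sum hGB l
  · rw [mul_zero]; exact J.zero_mem
  · intro x y _ _ hx hy
    rw [mul_add]; exact J.add_mem hx hy
  · intro r x _ hx
    rw [smul_eq_mul, mul_left_comm]; exact J.mul_mem_left r hx

/-! ### The complete-intersection cycle ideal `(f, g)` of `F = Σ f_i g_i` -/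

section CI

variable {k : ℕ}

/-- `2k + 2 = (k + 1) + (k + 1)`. [folklore] -/
private theorem twoMul_add_two_eq (k : ℕ) : 2 * k + 2 = (k + 1) + (k + 1) := by omega

/-- The **transition matrix of a complete-intersection presentation** `F = Σ_{i=0}^{k} f_i g_i` in the `2k+2`
variables `x_0, …, x_{2k+1}`: `B_{j l} = ∂ H'_l/∂ x_j` for the family `H' = (g_0, …, g_k, f_0, …, f_k)`, so that
`∂F/∂x_j = Σ_l B_{j l} H_l` with `H = (f_0, …, f_k, g_0, …, g_k)`; its determinant is, up to sign (the order of the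
forms), Villaflor's `det(Jac(H))`, `H = (f_1, g_1, …, f_{n/2+1}, g_{n/2+1})`.
[cite: Villaflor2022PeriodsCI, Thm. 1] -/
def ciTransitionMatrix (f g : Fin (k + 1) → MvPolynomial (Fin (2 * k + 2)) K) :
    Matrix (Fin (2 * k + 2)) (Fin (2 * k + 2)) (MvPolynomial (Fin (2 * k + 2)) K) :=
  Matrix.of fun j l => pderiv j (Fin.append g f (Fin.cast (twoMul_add_two_eq k) l))

/-- Entries of the transition matrix. [cite: Villaflor2022PeriodsCI, Thm. 1] -/
theorem ciTransitionMatrix_apply (f g : Fin (k + 1) → MvPolynomial (Fin (2 * k + 2)) K) (j l : Fin (2 * k + 2)) :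
    ciTransitionMatrix f g j l = pderiv j (Fin.append g f (Fin.cast (twoMul_add_two_eq k) l)) := rfl

/-- Sums over the concatenated family split into the two blocks. [folklore] -/
private theorem sum_append_cast {M : Type*} [AddCommMonoid M] (u v : Fin (k + 1) → MvPolynomial (Fin (2 * k + 2)) K)
    (φ : MvPolynomial (Fin (2 * k + 2)) K → Fin (2 * k + 2) → M) :
    ∑ l : Fin (2 * k + 2), φ (Fin.append u v (Fin.cast (twoMul_add_two_eq k) l)) l =
      ∑ i : Fin (k + 1), φ (u i) (Fin.cast (twoMul_add_two_eq k).symm (Fin.castAdd (k + 1) i)) +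
        ∑ i : Fin (k + 1), φ (v i) (Fin.cast (twoMul_add_two_eq k).symm (Fin.natAdd (k + 1) i)) := by
  have h := Fin.sum_congr' (M := M)
    (fun l' : Fin ((k + 1) + (k + 1)) => φ (Fin.append u v l') (Fin.cast (twoMul_add_two_eq k).symm l'))
    (twoMul_add_two_eq k)
  simp only [Fin.cast_cast, Fin.cast_eq_self] at h
  rw [h, Fin.sum_univ_add]
  simp only [Fin.append_left, Fin.append_right]

/-- `∂F/∂x_j = Σ_l B_{jl} H_l` for `F = Σ f_i g_i`, `H = (f, g)`, `B` the transition matrix. [folklore] -/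
private theorem pderiv_sum_mul_eq (f g : Fin (k + 1) → MvPolynomial (Fin (2 * k + 2)) K) (j : Fin (2 * k + 2)) :
    pderiv j (∑ i, f i * g i) =
      ∑ l, ciTransitionMatrix f g j l * Fin.append f g (Fin.cast (twoMul_add_two_eq k) l) := by
  have h := sum_append_cast (M := MvPolynomial (Fin (2 * k + 2)) K) f g
    (fun H l => ciTransitionMatrix f g j l * H)
  rw [h]
  simp only [ciTransitionMatrix_apply, Fin.cast_cast, Fin.cast_eq_self, Fin.append_left, Fin.append_right]
  rw [map_sum, ← Finset.sum_add_distrib]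
  exact Finset.sum_congr rfl fun i _ => by rw [pderiv_mul]; ring

/-- The concatenated family generates `(f) + (g)`. [folklore] -/
private theorem span_range_append_cast (f g : Fin (k + 1) → MvPolynomial (Fin (2 * k + 2)) K) :
    Ideal.span (Set.range fun l : Fin (2 * k + 2) => Fin.append f g (Fin.cast (twoMul_add_two_eq k) l)) =
      Ideal.span (Set.range f) ⊔ Ideal.span (Set.range g) := by
  rw [← Ideal.span_union]
  congr 1
  ext x
  constructor
  · rintro ⟨l, rfl⟩
    refine Fin.addCases (motive := fun l' : Fin ((k + 1) + (k + 1)) => Fin.append f g l' ∈ Set.range f ∪ Set.range g)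
      (fun i => ?_) (fun i => ?_) (Fin.cast (twoMul_add_two_eq k) l)
    · rw [Fin.append_left]; exact Or.inl ⟨i, rfl⟩
    · rw [Fin.append_right]; exact Or.inr ⟨i, rfl⟩
  · rintro (⟨i, rfl⟩ | ⟨i, rfl⟩)
    · exact ⟨Fin.cast (twoMul_add_two_eq k).symm (Fin.castAdd (k + 1) i), by
        simp only [Fin.cast_cast, Fin.cast_eq_self, Fin.append_left]⟩
    · exact ⟨Fin.cast (twoMul_add_two_eq k).symm (Fin.natAdd (k + 1) i), by
        simp only [Fin.cast_cast, Fin.cast_eq_self, Fin.append_right]⟩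

open Literature.AlgebraicGeometry.Motives.UniversalHypersurface

/-- **The Artinian Gorenstein ideal of a complete-intersection cycle** (Villaflor Loyola 2022b, Example 2.1;
Kloosterman 2023, Example 4.6 and Lemma 4.12 — algebraic form). Let `F = Σ_{i=0}^{k} f_i g_i` in the `2k + 2`
variables `x_0, …, x_{2k+1}`, with `f_i`, `g_i` forms of positive degrees `a_i`, `b_i`, `a_i + b_i = d`, and suppose
the Jacobian ring `S/J^F` is finite-dimensional (a power of every variable lies in `J^F`; every smooth
`X = {F = 0} ⊃ Z = {f = 0}`). Let `D = det (∂(g,f)/∂x)` be the Jacobian determinant of the `2k+2` forms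
(`ciTransitionMatrix`; Villaflor's `det Jac(H)` up to sign). Then `D ∉ J^F` and
`(J^F : D) = (f_0, …, f_k) + (g_0, …, g_k)` — "`I := ⟨f_1, g_1, …, f_{n/2+1}, g_{n/2+1}⟩ ⊆ J^{F,λ}` … by
Macaulay's theorem … `I = J^{F,λ}`". [cite: Villaflorloyola2021, Example 2.1] [cite: Kloosterman2023, Lemma 4.12]
[cite: Villaflor2022PeriodsCI, Thm. 1] -/
theorem det_ciTransitionMatrix_notMem_and_colon_eq {d : ℕ} (f g : Fin (k + 1) → MvPolynomial (Fin (2 * k + 2)) K)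
    (a b : Fin (k + 1) → ℕ) (hf : ∀ i, (f i).IsHomogeneous (a i)) (hg : ∀ i, (g i).IsHomogeneous (b i))
    (ha : ∀ i, 0 < a i) (hb : ∀ i, 0 < b i) (hab : ∀ i, a i + b i = d) {N : ℕ} (hN : 0 < N)
    (hXN : ∀ j, (X j : MvPolynomial (Fin (2 * k + 2)) K) ^ N ∈ jacobianIdeal (∑ i, f i * g i)) :
    (ciTransitionMatrix f g).det ∉ jacobianIdeal (∑ i, f i * g i) ∧
      (jacobianIdeal (∑ i, f i * g i)).colon {(ciTransitionMatrix f g).det} =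
        Ideal.span (Set.range f) ⊔ Ideal.span (Set.range g) := by
  classical
  -- the data of the general theorem
  set H : Fin (2 * k + 2) → MvPolynomial (Fin (2 * k + 2)) K :=
    fun l => Fin.append f g (Fin.cast (twoMul_add_two_eq k) l) with hH
  set e : Fin (2 * k + 2) → ℕ := fun l => Fin.append a b (Fin.cast (twoMul_add_two_eq k) l) with he
  set e' : Fin (2 * k + 2) → ℕ := fun l => Fin.append b a (Fin.cast (twoMul_add_two_eq k) l) with he'
  have hd2 : 2 ≤ d := by have := hab 0; have := ha 0; have := hb 0; omega
  have hF : (∑ i, f i * g i).IsHomogeneous d :=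
    IsHomogeneous.sum _ _ _ fun i _ => by rw [← hab i]; exact (hf i).mul (hg i)
  have hHhom : ∀ l, (H l).IsHomogeneous (e l) := by
    intro l
    refine Fin.addCases (motive := fun l' : Fin ((k + 1) + (k + 1)) =>
      (Fin.append f g l').IsHomogeneous (Fin.append a b l')) (fun i => ?_) (fun i => ?_)
      (Fin.cast (twoMul_add_two_eq k) l)
    · rw [Fin.append_left, Fin.append_left]; exact hf i
    · rw [Fin.append_right, Fin.append_right]; exact hg i
  have hepos : ∀ l, 0 < e l := by
    intro l
    refine Fin.addCases (motive := fun l' : Fin ((k + 1) + (k + 1)) => 0 < Fin.append a b l')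
      (fun i => ?_) (fun i => ?_) (Fin.cast (twoMul_add_two_eq k) l)
    · rw [Fin.append_left]; exact ha i
    · rw [Fin.append_right]; exact hb i
  -- the transition matrix: column `l` consists of forms of degree `e' l − 1`
  have hBcol : ∀ j l, (ciTransitionMatrix f g j l).IsHomogeneous (e' l - 1) := by
    intro j l
    rw [ciTransitionMatrix_apply]
    refine Fin.addCases (motive := fun l' : Fin ((k + 1) + (k + 1)) =>
      (pderiv j (Fin.append g f l')).IsHomogeneous (Fin.append b a l' - 1)) (fun i => ?_) (fun i => ?_)
      (Fin.cast (twoMul_add_two_eq k) l)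
    · rw [Fin.append_left, Fin.append_left]; exact (hg i).pderiv
    · rw [Fin.append_right, Fin.append_right]; exact (hf i).pderiv
  have hBt : (ciTransitionMatrix f g).det.IsHomogeneous (∑ l, (e' l - 1)) := by
    rw [← Matrix.det_transpose]
    exact Literature.AlgebraicGeometry.DeterminantalHypersurfaces.isHomogeneous_det_of_rows
      (X := (ciTransitionMatrix f g).transpose) (r := fun l => e' l - 1) fun l j => hBcol j l
  -- degree bookkeeping: `Σ (e' l − 1) + Σ (e l − 1) = (2k+2)(d−2) = Σ_j (d − 1 − 1)`
  have hsum_e : ∑ l, (e l - 1) = ∑ i, (a i - 1) + ∑ i, (b i - 1) := by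
    have h := sum_append_cast (M := ℕ) (K := K) (k := k) (fun _ => 0) (fun _ => 0) (fun _ l => e l - 1)
    rw [h]
    simp only [he, Fin.cast_cast, Fin.cast_eq_self, Fin.append_left, Fin.append_right]
  have hsum_e' : ∑ l, (e' l - 1) = ∑ i, (b i - 1) + ∑ i, (a i - 1) := by
    have h := sum_append_cast (M := ℕ) (K := K) (k := k) (fun _ => 0) (fun _ => 0) (fun _ l => e' l - 1)
    rw [h]
    simp only [he', Fin.cast_cast, Fin.cast_eq_self, Fin.append_left, Fin.append_right]
  have ht : ∑ l, (e' l - 1) + ∑ l, (e l - 1) = ∑ _j : Fin (2 * k + 2), (d - 1 - 1) := by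
    rw [hsum_e, hsum_e', Finset.sum_const, Finset.card_univ, Fintype.card_fin, smul_eq_mul]
    have h1 : ∑ i, (a i - 1) + ∑ i, (b i - 1) = (k + 1) * (d - 2) := by
      rw [← Finset.sum_add_distrib, show (k + 1) * (d - 2) = ∑ _i : Fin (k + 1), (d - 2) by simp]
      exact Finset.sum_congr rfl fun i _ => by have := hab i; have := ha i; have := hb i; omega
    have h2 : d - 1 - 1 = d - 2 := by omega
    rw [h2]
    linarith [h1]
  have hmain := det_notMem_and_colon_det_eq_of_eq_mul (fun j => pderiv j (∑ i, f i * g i)) H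
    (fun _ => d - 1) e (fun j => hF.pderiv) (fun _ => by omega) hHhom hepos hN hXN (ciTransitionMatrix f g)
    (pderiv_sum_mul_eq f g) hBt ht
  rw [hH, span_range_append_cast] at hmain
  exact hmain

/-- **The ideal `(f) + (g)` of a complete-intersection presentation is Artinian Gorenstein of socle degree
`(k+1)(d−2) = (d−2)(n/2+1)`** (Kloosterman 2023, Example 4.6: "`S/(P_1, …, P_{k+1}, Q_1, …, Q_{k+1})` is an example
of an Artinian Gorenstein algebra. Its socle degree equals … `(k+1)e − 2k − 2`"), under the same hypotheses.
[cite: Kloosterman2023, Example 4.6] [cite: VoisinHodgeII2003, Thm. 6.19] -/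
theorem isArtinianGorenstein_span_sup_span {d : ℕ} (f g : Fin (k + 1) → MvPolynomial (Fin (2 * k + 2)) K)
    (a b : Fin (k + 1) → ℕ) (hf : ∀ i, (f i).IsHomogeneous (a i)) (hg : ∀ i, (g i).IsHomogeneous (b i))
    (ha : ∀ i, 0 < a i) (hb : ∀ i, 0 < b i) (hab : ∀ i, a i + b i = d) {N : ℕ} (hN : 0 < N)
    (hXN : ∀ j, (X j : MvPolynomial (Fin (2 * k + 2)) K) ^ N ∈ jacobianIdeal (∑ i, f i * g i)) :
    IsArtinianGorenstein (Ideal.span (Set.range f) ⊔ Ideal.span (Set.range g)) ((k + 1) * (d - 2)) := by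
  have hd2 : 2 ≤ d := by have := hab 0; have := ha 0; have := hb 0; omega
  have hF : (∑ i, f i * g i).IsHomogeneous d :=
    IsHomogeneous.sum _ _ _ fun i _ => by rw [← hab i]; exact (hf i).mul (hg i)
  obtain ⟨hdet, hcolon⟩ := det_ciTransitionMatrix_notMem_and_colon_eq f g a b hf hg ha hb hab hN hXN
  rw [← hcolon]
  have hfin : IsArtinianGorenstein (jacobianIdeal (∑ i, f i * g i)) ((2 * k + 1 + 1) * (d - 2)) := by
    have h := isArtinianGorenstein_span_of_X_pow_mem (fun j : Fin (2 * k + 2) => pderiv j (∑ i, f i * g i))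
      (fun _ => d - 1) (fun j => hF.pderiv) (fun _ => by omega) hN hXN
    simp only [Finset.sum_const, Finset.card_univ, Fintype.card_fin, smul_eq_mul] at h
    have hd' : d - 1 - 1 = d - 2 := by omega
    rw [hd'] at h
    exact h
  -- `deg D = (k+1)(d−2)`: read off from the colon identity's socle arithmetic via `colon`
  have hDdeg : (ciTransitionMatrix f g).det.IsHomogeneous ((k + 1) * (d - 2)) := by
    classical
    have hcol : ∀ j l, (ciTransitionMatrix f g j l).IsHomogeneous
        (Fin.append b a (Fin.cast (twoMul_add_two_eq k) l) - 1) := by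
      intro j l
      rw [ciTransitionMatrix_apply]
      refine Fin.addCases (motive := fun l' : Fin ((k + 1) + (k + 1)) =>
        (pderiv j (Fin.append g f l')).IsHomogeneous (Fin.append b a l' - 1)) (fun i => ?_) (fun i => ?_)
        (Fin.cast (twoMul_add_two_eq k) l)
      · rw [Fin.append_left, Fin.append_left]; exact (hg i).pderiv
      · rw [Fin.append_right, Fin.append_right]; exact (hf i).pderiv
    have h := Literature.AlgebraicGeometry.DeterminantalHypersurfaces.isHomogeneous_det_of_rows
      (X := (ciTransitionMatrix f g).transpose)
      (r := fun l => Fin.append b a (Fin.cast (twoMul_add_two_eq k) l) - 1) fun l j => hcol j l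
    rw [Matrix.det_transpose] at h
    have hs : ∑ l : Fin (2 * k + 2), (Fin.append b a (Fin.cast (twoMul_add_two_eq k) l) - 1) = (k + 1) * (d - 2) := by
      have h' := sum_append_cast (M := ℕ) (K := K) (k := k) (fun _ => 0) (fun _ => 0)
        (fun _ l => Fin.append b a (Fin.cast (twoMul_add_two_eq k) l) - 1)
      rw [h']
      simp only [Fin.cast_cast, Fin.cast_eq_self, Fin.append_left, Fin.append_right]
      rw [← Finset.sum_add_distrib, show (k + 1) * (d - 2) = ∑ _i : Fin (k + 1), (d - 2) by simp]
      exact Finset.sum_congr rfl fun i _ => by have := hab i; have := ha i; have := hb i; omega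
    rwa [hs] at h
  exact hfin.colon hDdeg (by ring) hdet

end CI

/-! ### The socle of `S/(G)` is spanned by the transition determinant (de Smit–Rubin–Schoof Prop. 2.1 (i)) -/

/-- **The socle of an Artinian complete intersection of forms is spanned by the transition determinant**
(de Smit–Rubin–Schoof, Prop. 2.1 (i) "`Ann_A(I_A) = (d)`", `d = det(g_{ij})`, `f_i = Σ_j g_{ij} X_j`, and Cor. 2.2
"`(d)` is the unique minimal non-zero ideal of `A`", in the graded polynomial ring, where `K[x]/(G) = K[[x]]/(G)`
because `(G)` is `(x)`-primary): for forms `G_0, …, G_{m−1}` of positive degree in `m` variables with a power of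
every variable in `(G)` and any matrix `A` with `G_j = Σ_i A_{ji} x_i`,
`((G) : (x_0, …, x_{m−1})) = (G) + (det A)` and `det A ∉ (G)`.
[cite: DeSmitRubinSchoof1997, Prop. 2.1 (i), Cor. 2.2] -/
theorem colon_originIdeal_eq_sup_span_det (G : Fin m → MvPolynomial (Fin m) K) (d : Fin m → ℕ)
    (hG : ∀ j, (G j).IsHomogeneous (d j)) (hd : ∀ j, 0 < d j) {N : ℕ} (hN : 0 < N)
    (hXN : ∀ i, (X i : MvPolynomial (Fin m) K) ^ N ∈ Ideal.span (Set.range G))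
    (A : Matrix (Fin m) (Fin m) (MvPolynomial (Fin m) K)) (hGA : ∀ j, G j = ∑ i, A j i * X i) :
    A.det ∉ Ideal.span (Set.range G) ∧
      (Ideal.span (Set.range G)).colon (originIdeal K m : Set (MvPolynomial (Fin m) K)) =
        Ideal.span (Set.range G) ⊔ Ideal.span {A.det} := by
  classical
  set I : Ideal (MvPolynomial (Fin m) K) := Ideal.span (Set.range G) with hI
  have hDI : A.det ∉ I := fun h =>
    Literature.RingTheory.CompleteIntersection.det_notMem_span_sup_span_X_pow_of_mem A G 1 hN hGA
      (fun i => by rw [one_mul]; exact hXN i) (by simp) (Ideal.mem_sup_left h)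
  -- `𝔫 · det A ⊆ I` (Cramer)
  have h𝔫D : ∀ q ∈ originIdeal K m, q * A.det ∈ I := by
    intro q hq
    rw [originIdeal_eq_span] at hq
    obtain ⟨c, rfl⟩ := Ideal.mem_span_range_iff_exists_fun.mp hq
    rw [Finset.sum_mul]
    exact I.sum_mem fun i _ => by
      rw [mul_assoc, mul_comm (X i), ]
      exact I.mul_mem_left _ (det_mul_mem_span_of_eq_sum hGA i)
  refine ⟨hDI, le_antisymm ?_ (sup_le (fun x hx => Ideal.le_colon hx) ?_)⟩
  · intro g hg
    by_cases hgI : g ∈ I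
    · exact Ideal.mem_sup_left hgI
    obtain ⟨M, hM⟩ : ∃ M : ℕ, originIdeal K m ^ M ≤ I := by
      refine Ideal.exists_pow_le_of_le_radical_of_fg ?_ (IsNoetherian.noetherian _)
      rw [originIdeal_eq_span, Ideal.span_le]
      rintro _ ⟨i, rfl⟩
      exact ⟨N, hXN i⟩
    have hG𝔫 : ∀ j, G j ∈ originIdeal K m := fun j => by
      rw [mem_originIdeal_iff, constantCoeff_eq]
      exact (hG j).coeff_eq_zero (by rw [map_zero]; have := hd j; omega)
    obtain ⟨u, p, hu, hup⟩ := exists_mul_det_sub_mul_mem hGA hM hG𝔫 hgI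
    have hg𝔫 : ∀ q ∈ originIdeal K m, q * g ∈ I := fun q hq => by
      have := Submodule.mem_colon.mp hg q hq
      rwa [smul_eq_mul, mul_comm] at this
    have h1 : (u - C (constantCoeff u)) * A.det ∈ I :=
      h𝔫D _ (by rw [mem_originIdeal_iff, map_sub, constantCoeff_C, sub_self])
    have h2 : (p - C (constantCoeff p)) * g ∈ I :=
      hg𝔫 _ (by rw [mem_originIdeal_iff, map_sub, constantCoeff_C, sub_self])
    have h3 : C (constantCoeff u) * A.det - C (constantCoeff p) * g ∈ I := by
      have : C (constantCoeff u) * A.det - C (constantCoeff p) * g =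
          (u * A.det - p * g) - (u - C (constantCoeff u)) * A.det + (p - C (constantCoeff p)) * g := by ring
      rw [this]
      exact I.add_mem (I.sub_mem hup h1) h2
    have hp0 : constantCoeff p ≠ 0 := by
      intro h0
      rw [h0, C_0, zero_mul, sub_zero] at h3
      refine hDI ?_
      have : A.det = C (constantCoeff u)⁻¹ * (C (constantCoeff u) * A.det) := by
        rw [← mul_assoc, ← C_mul, inv_mul_cancel₀ hu, C_1, one_mul]
      rw [this]
      exact I.mul_mem_left _ h3
    -- `g = c⁻¹ (C c g − C u₀ D) + (c⁻¹ u₀) D`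
    have hdecomp : g = C (constantCoeff p)⁻¹ * (C (constantCoeff p) * g - C (constantCoeff u) * A.det) +
        C ((constantCoeff p)⁻¹ * constantCoeff u) * A.det := by
      have : C (constantCoeff p)⁻¹ * C (constantCoeff p) = (1 : MvPolynomial (Fin m) K) := by
        rw [← C_mul, inv_mul_cancel₀ hp0, C_1]
      rw [C_mul]
      linear_combination (-g) * this
    rw [hdecomp]
    refine Submodule.add_mem_sup (I.mul_mem_left _ ?_) (Ideal.mul_mem_left _ _ (Ideal.mem_span_singleton_self _))
    have : C (constantCoeff p) * g - C (constantCoeff u) * A.det = -(C (constantCoeff u) * A.det - C (constantCoeff p) * g) := by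
      ring
    rw [this]
    exact I.neg_mem h3
  · rw [Ideal.span_singleton_le_iff_mem, Submodule.mem_colon]
    intro q hq
    rw [smul_eq_mul, mul_comm]
    exact h𝔫D q hq

/-! ### The Hessian determinant spans the socle of the Jacobian ring -/

/-- The **Hessian matrix** `(∂²F/∂x_i ∂x_j)` of a polynomial in `m` variables (Villaflor's `Hess(F)`).
[cite: Villaflor2022PeriodsCI, Thm. 2] -/
def hessianMatrix (F : MvPolynomial (Fin m) K) : Matrix (Fin m) (Fin m) (MvPolynomial (Fin m) K) :=
  Matrix.of fun i j => pderiv i (pderiv j F)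

/-- Entries of the Hessian matrix. [cite: Villaflor2022PeriodsCI, Thm. 2] -/
theorem hessianMatrix_apply (F : MvPolynomial (Fin m) K) (i j : Fin m) :
    hessianMatrix F i j = pderiv i (pderiv j F) := rfl

/-- **`det Hess(F)` spans the socle of the Jacobian ring** (Villaflor 2022, after Thm. 2: "the Jacobian ring
`R^F` satisfies `R^F_{(d−2)(n+2)} = ℂ·det(Hess(F))`. This is consequence of a classical theorem due to Macaulay";
de Smit–Rubin–Schoof Prop. 2.1 (i) with the transition matrix `Hess(F)/(d−1)` given by Euler's identity
`(d−1)·∂F/∂x_i = Σ_j x_j ∂²F/∂x_j∂x_i`): for a form `F` of degree `d ≥ 2` in `m` variables with `d − 1 ≠ 0` in `K`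
and a power of every variable in `J^F = (∂F/∂x_0, …, ∂F/∂x_{m−1})`,
`det Hess(F) ∉ J^F` and `(J^F : (x_0, …, x_{m−1})) = J^F + (det Hess(F))`.
[cite: Villaflor2022PeriodsCI, Thm. 2] [cite: DeSmitRubinSchoof1997, Prop. 2.1 (i)] -/
theorem det_hessianMatrix_notMem_and_colon_originIdeal_eq {F : MvPolynomial (Fin m) K} {d : ℕ}
    (hF : F.IsHomogeneous d) (hd : 2 ≤ d) (hdK : ((d - 1 : ℕ) : K) ≠ 0) {N : ℕ} (hN : 0 < N)
    (hXN : ∀ i, (X i : MvPolynomial (Fin m) K) ^ N ∈ Ideal.span (Set.range fun j : Fin m => pderiv j F)) :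
    (hessianMatrix F).det ∉ Ideal.span (Set.range fun j : Fin m => pderiv j F) ∧
      (Ideal.span (Set.range fun j : Fin m => pderiv j F)).colon (originIdeal K m : Set (MvPolynomial (Fin m) K)) =
        Ideal.span (Set.range fun j : Fin m => pderiv j F) ⊔ Ideal.span {(hessianMatrix F).det} := by
  classical
  set c : K := ((d - 1 : ℕ) : K)⁻¹ with hc
  -- the transition matrix `A = Hess(F)ᵀ / (d − 1)`: `∂_i F = Σ_j A_{ij} x_j` by Euler's identity for `∂_i F`
  set A : Matrix (Fin m) (Fin m) (MvPolynomial (Fin m) K) :=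
    (C c : MvPolynomial (Fin m) K) • (hessianMatrix F).transpose with hA
  have hGA : ∀ i, pderiv i F = ∑ j, A i j * X j := by
    intro i
    have heuler := (hF.pderiv (i := i)).sum_X_mul_pderiv
    simp only [hA, Matrix.smul_apply, Matrix.transpose_apply, hessianMatrix_apply, smul_eq_mul]
    calc pderiv i F = C c * ((d - 1 : ℕ) • pderiv i F) := by
            rw [nsmul_eq_mul, ← mul_assoc, ← map_natCast (C : K →+* MvPolynomial (Fin m) K), ← C_mul, hc,
              inv_mul_cancel₀ hdK, C_1, one_mul]
      _ = C c * ∑ j, X j * pderiv j (pderiv i F) := by rw [heuler]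
      _ = ∑ j, C c * pderiv j (pderiv i F) * X j := by
            rw [Finset.mul_sum]
            exact Finset.sum_congr rfl fun j _ => by ring
  obtain ⟨hdetA, hcolon⟩ := colon_originIdeal_eq_sup_span_det (fun j : Fin m => pderiv j F) (fun _ => d - 1)
    (fun j => hF.pderiv) (fun _ => by omega) hN hXN A hGA
  have hdet : A.det = C (c ^ m) * (hessianMatrix F).det := by
    rw [hA, Matrix.det_smul, Matrix.det_transpose, Fintype.card_fin, ← map_pow]
  have hunit : IsUnit (C (c ^ m) : MvPolynomial (Fin m) K) :=
    (IsUnit.pow m (isUnit_iff_ne_zero.mpr (inv_ne_zero hdK))).map C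
  refine ⟨fun h => hdetA ?_, ?_⟩
  · rw [hdet]
    exact Ideal.mul_mem_left _ _ h
  · rw [hcolon, hdet, Ideal.span_singleton_mul_left_unit hunit]

end Literature.AlgebraicGeometry.HodgeTheory
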